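import Summits.Ventures.HSemireg.SheafSeedOnAnchor
import Summits.Ventures.HSemireg.TwelvefoldDoor
import Summits.Ventures.HSemireg.HigherSigmaOfIso
import Literature.AlgebraicGeometry.HodgeTheory.ISemiregularOfSchemeIso
import HarnessLib

/-!
# Venture HSemireg — the SHEAF door: the every-model and the one-model seed predicates are EQUIVALENT, and every
# one-model door holds with Buchweitz–Flenner Thm. 5.1 in its FIXED-FIBRE rendering

HONEST FRAMING. Interface file of the computation cell `pub-hsemireg`, track «S4-PUSH» (iii), seat s4-bridge-1 (bridge (B1),
obligation (T-σ)). Nothing about any explicit variety is asserted; every published input is a hypothesis BY NAME; nothing here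
says that HC, HC_CM or HC_AV is proved; no object is certified. THEOREMS ONLY: no `def`, no named fact, no `sorry`.

`SheafSeed.lean` asks the sheaf seed on EVERY model `e : P.X ≅ X₀` (`HasBFSheafSeedAt`) because the refereed fact
`BuchweitzFlenner2003_variationalHodge_ISemiregular` wants `ℰ₀` on the chosen fibre; `SheafSeedOnAnchor.lean` asks it on ONE
model (`HasBFSheafSeedOn`) at the price of the model rendering `BuchweitzFlenner2003_variationalHodge_ISemiregular_model`, printing
«the tree cannot transport `IsISemiregular` along `e`». The Literature theorem
`Literature.AlgebraicGeometry.HodgeTheory.IsISemiregular.of_schemeIso` (`ISemiregularOfSchemeIso.lean`) now DOES transport it, and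
`BuchweitzFlenner2003_variationalHodge_ISemiregular_model_of_fixed` derives the model rendering from the fixed-fibre one. Hence:

* `isISemiregular_iff_of_schemeIso` — `IsISemiregular hE J ↔ IsISemiregular (hE.pushforward_of_iso _) J` (the converse by
  transporting back along `e⁻¹` and the venture's module-level invariance `isISemiregular_of_iso`, `HigherSigmaOfIso.lean`);
* `hasBFSheafSeedAt_of_hasBFSheafSeedOn`, `hasBFSheafSeedAt_iff_hasBFSheafSeedOn` — ONE object on ONE model IS the
  every-model seed (push `ℰ₀` forward along each `e`: finite locally free, `I`-semiregular there, `e^* ch_p(e_*ℰ₀) = ch_p(ℰ₀)`);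
* `hasHyperbolicBFSheafSeed_iff_hasHyperbolicBFSheafSeedOn` — the same for the hyperbolic-anchor predicates;
* `hasLocallyAlgebraicWeilAnchor_of_BF_of_hyperbolicBFSheafSeedOn` — the one-model sheaf door with Thm. 5.1 in its
  FIXED-FIBRE rendering: `BuchweitzFlenner2003_variationalHodge_ISemiregular ∧ HasHyperbolicBFSheafSeedOn C N d I ⟹
  HasLocallyAlgebraicWeilAnchor N d`; and at the S4 RUNG `N = 6` (`TwelvefoldDoor.lean`):
  `weilTwelvefoldsSplit_and_below_of_BF_of_hyperbolicBFSheafSeedOn_six`, `weilTwelvefoldsSplit_and_below_of_BF_of_sheaf_six`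
  (BY VALUE: one finite locally free `ℰ₀` ON `P.X`, σ ×2 and CLASS ×2 certificates) with the FIXED-FIBRE fact;
* on an ARBITRARY discriminant component `(n, d, δ)` (`ComponentCells.lean`, door D2 in one-model form — the cells where the
  existence clause of (S4) is OPEN are the NON-SPLIT ones): `weilAnchorLocalClause_of_BF_of_sheafSeedOn`,
  `weilClassesComponent_of_BF_of_sheafSeedOn_member`, `weilSixfoldComponent_of_BF_of_sheafSeedOn_member` — reach-by-similitude
  `weilFamilyReach_similar` ∧ Thm. 5.1 (FIXED-FIBRE rendering) ∧ ONE object on ONE member ⟹ `WeilClassesComponent n d δ`.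

Net effect for the trust base: the sheaf door of record takes ONE object on ONE model AND rests on ONE printed theorem
(Thm. 5.1, fixed-fibre rendering), like the lci doors; CAVEAT C1 (finite locally free `ℰ₀` only) is unchanged.

References: [BuchweitzFlenner2003] §5 Thm. 5.1, §5 (I-semiregular); [Fulton1998] §15.1 (ii); [Deligne1982HodgeCycles] proof of
Thm. 4.8; [vanGeemen1994HodgeAV] Lemma 5.2 (3)–(4) and 5.3.
-/

noncomputable section

open CategoryTheory AlgebraicGeometry
open AlgebraicGeometry.Scheme.Modules

namespace Summit.Ventures.HSemireg

open Literature.AlgebraicGeometry Literature.AlgebraicGeometry.Motives Literature.AlgebraicGeometry.Modules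
open Literature.AlgebraicGeometry.HodgeTheory
open Literature.AlgebraicGeometry.VanGeemen1994
open Literature.AlgebraicTopology.SingularHomology
open Summit.HodgeConjecture.HodgeConjecture
open Summit.HodgeConjecture.HodgeConjecture.Ring2.Hypotheses
open Summit.HodgeConjecture.HodgeConjecture.Ring2.AbelianAll
open Summit.HodgeConjecture.HodgeConjecture.WeilTypeLadder
open Summit.HodgeConjecture.HodgeConjecture.Cruxes.HodgeAbelianVarieties.EStepSecantInduction
open Summit.Ventures.HSemireg.GeneralStructure

/-- **Buchweitz–Flenner `I`-semiregularity of `E` and of `e_* E` are EQUIVALENT** for an isomorphism `e : X₀ ≅ X₁` of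
`S`-schemes: `⟹` is the Literature theorem `IsISemiregular.of_schemeIso`; `⟸` transports back along `e⁻¹`
(`(e⁻¹)_* e_* E ≅ E`, `isoPushforwardInvPushforward`) and uses the module-level invariance `isISemiregular_of_iso`.
[cite: BuchweitzFlenner2003, §5 (I-semiregular)] -/
theorem isISemiregular_iff_of_schemeIso {S : Type} [CommRing S] {X₀ X₁ : Over (Spec (CommRingCat.of S))} (e : X₀ ≅ X₁)
    {E : X₀.left.Modules} (hE : IsFiniteLocallyFree E) (J : Set ℕ) :
    IsISemiregular hE J ↔ IsISemiregular (hE.pushforward_of_iso (leftIso' e)) J := by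
  refine ⟨IsISemiregular.of_schemeIso e hE, fun h => ?_⟩
  have h' := IsISemiregular.of_schemeIso e.symm (hE.pushforward_of_iso (leftIso' e)) h
  exact isISemiregular_of_iso (isoPushforwardInvPushforward (leftIso' e) E).symm _ hE h'

/-- **The one-model seed gives the every-model seed**: push `ℰ₀` forward along each model `e : P.X ≅ X₀` — `e_*ℰ₀` is finite
locally free (`IsFiniteLocallyFree.pushforward_of_iso`), `I`-semiregular (`IsISemiregular.of_schemeIso`), and
`e^* ch_p(e_*ℰ₀) = e^*(e⁻¹)^* ch_p(ℰ₀) = ch_p(ℰ₀)` (`ChernCharacterBetti.ch_pushforward_of_iso`).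
[cite: BuchweitzFlenner2003, §5 (I-semiregular)] [cite: Fulton1998, §15.1 (ii)] -/
theorem hasBFSheafSeedAt_of_hasBFSheafSeedOn {C : ChernCharacterBetti} {n : ℕ} {I : Finset ℕ}
    {P : AbelianVariety ℂ} {h : complexBetti P.X 2} {w : complexBetti P.X (2 * n)}
    (hS : HasBFSheafSeedOn C n I P h w) : HasBFSheafSeedAt C n I P h w := by
  obtain ⟨E₀, hE₀, q, c, hnI, hsr, hchn, hchp⟩ := hS
  intro X₀ e
  refine ⟨(pushforward e.hom.left).obj E₀, hE₀.pushforward_of_iso (leftIso' e), q, c, hnI,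
    IsISemiregular.of_schemeIso e hE₀ hsr, ?_, fun p hp hpn => ?_⟩
  · rw [ChernCharacterBetti.ch_pushforward_of_iso C e hE₀,
      BuchweitzFlenner2003_variationalHodge_ISemiregular_model.map_hom_map_inv, hchn]
  · rw [ChernCharacterBetti.ch_pushforward_of_iso C e hE₀,
      BuchweitzFlenner2003_variationalHodge_ISemiregular_model.map_hom_map_inv, hchp p hp hpn]

/-- **The every-model and the one-model sheaf seeds are equivalent.** [cite: BuchweitzFlenner2003, §5 (I-semiregular)] -/
theorem hasBFSheafSeedAt_iff_hasBFSheafSeedOn {C : ChernCharacterBetti} {n : ℕ} {I : Finset ℕ}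
    {P : AbelianVariety ℂ} {h : complexBetti P.X 2} {w : complexBetti P.X (2 * n)} :
    HasBFSheafSeedAt C n I P h w ↔ HasBFSheafSeedOn C n I P h w :=
  ⟨hasBFSheafSeedOn_of_hasBFSheafSeedAt, hasBFSheafSeedAt_of_hasBFSheafSeedOn⟩

/-- **The hyperbolic-anchor sheaf seeds, every-model and one-model, are equivalent.**
[cite: BuchweitzFlenner2003, §5 (I-semiregular)] -/
theorem hasHyperbolicBFSheafSeed_iff_hasHyperbolicBFSheafSeedOn {C : ChernCharacterBetti} {N d : ℕ} {I : Finset ℕ} :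
    GeneralStructure.HasHyperbolicBFSheafSeed C N d I ↔ HasHyperbolicBFSheafSeedOn C N d I := by
  refine ⟨hasHyperbolicBFSheafSeedOn_of_hasHyperbolicBFSheafSeed, fun hS => ?_⟩
  obtain ⟨P, ψ₀, e, a, w, hP, hψ, ha, ha0, hhyp, hwW, hwr, hw0, hseed⟩ := hS
  exact ⟨P, ψ₀, e, a, w, hP, hψ, ha, ha0, hhyp, hwW, hwr, hw0, hasBFSheafSeedAt_of_hasBFSheafSeedOn hseed⟩

/-- **The one-model sheaf door with Thm. 5.1 in its FIXED-FIBRE rendering**: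
`[Buchweitz–Flenner 5.1] ∧ HasHyperbolicBFSheafSeedOn C N d I ⟹ HasLocallyAlgebraicWeilAnchor N d`
(`hasLocallyAlgebraicWeilAnchor_of_BFmodel_of_hyperbolicBFSheafSeedOn` with the model rendering supplied by
`BuchweitzFlenner2003_variationalHodge_ISemiregular_model_of_fixed`). [cite: BuchweitzFlenner2003, §5 Thm. 5.1]
[cite: Deligne1982HodgeCycles, proof of Thm. 4.8] -/
theorem hasLocallyAlgebraicWeilAnchor_of_BF_of_hyperbolicBFSheafSeedOn {C : ChernCharacterBetti} {N d : ℕ}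
    {I : Finset ℕ} (hBF : BuchweitzFlenner2003_variationalHodge_ISemiregular)
    (hS : HasHyperbolicBFSheafSeedOn C N d I) : HasLocallyAlgebraicWeilAnchor N d :=
  hasLocallyAlgebraicWeilAnchor_of_BFmodel_of_hyperbolicBFSheafSeedOn
    (BuchweitzFlenner2003_variationalHodge_ISemiregular_model_of_fixed hBF) hS

/-! ## The S4 rung `N = 6`: the one-model BF doors of `TwelvefoldDoor.lean` with the fixed-fibre fact -/

/-- **BF door at `N = 6`, one-model seed, FIXED-FIBRE fact**: `[Buchweitz–Flenner 5.1] ∧ reach ∧ HasHyperbolicBFSheafSeedOn C 6 d I ⟹`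
every split `√-d`-Weil twelvefold and `WeilAlgebraicAll 5 d ∧ 4 ∧ 3 ∧ 2` (`TwelvefoldDoor`'s `…_of_BFmodel_…_six` with the model
rendering supplied by `BuchweitzFlenner2003_variationalHodge_ISemiregular_model_of_fixed`). [cite: BuchweitzFlenner2003, §5 Thm. 5.1]
[cite: Deligne1982HodgeCycles, proof of Thm. 4.8] [cite: Schoen1998HodgeWeilAddendum, 10 (Proposition), p. 332] -/
theorem weilTwelvefoldsSplit_and_below_of_BF_of_hyperbolicBFSheafSeedOn_six
    (hBF : BuchweitzFlenner2003_variationalHodge_ISemiregular) (hF : weilFamilyReach_hyperbolic)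
    {C : ChernCharacterBetti} {I : Finset ℕ} {d : ℕ} (hd : 0 < d) (hS : HasHyperbolicBFSheafSeedOn C 6 d I) :
    Stubs.WeilAlgebraicSplitHyperplane 6 d ∧
      (WeilAlgebraicAll 5 d ∧ WeilAlgebraicAll 4 d ∧ WeilAlgebraicAll 3 d ∧ WeilAlgebraicAll 2 d) :=
  weilTwelvefoldsSplit_and_below_of_BFmodel_of_hyperbolicBFSheafSeedOn_six
    (BuchweitzFlenner2003_variationalHodge_ISemiregular_model_of_fixed hBF) hF hd hS

/-- **BF door at `N = 6` BY VALUE, FIXED-FIBRE fact**: a CM/hyperbolic anchor `(P, ψ₀, e, a)` of dimension `12`, a non-zero rational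
`w` in its Weil plane, `I ∋ 6`, ONE finite locally free `ℰ₀` ON `P.X` with `(σ_q)_{q+1 ∈ I}` jointly injective (σ ×2 certificate) and
`ch₆(ℰ₀) = q·h_K⁶ + w`, `ch_p(ℰ₀) = c_p·h_Kᵖ` off `6` (CLASS ×2 certificate) ⟹ under `weilFamilyReach_hyperbolic` and BF Thm. 5.1
(FIXED-FIBRE rendering, refereed named fact) every split `√-d`-Weil twelvefold and `WeilAlgebraicAll 5 d ∧ 4 ∧ 3 ∧ 2`. Scope: `ℰ₀`
finite locally free, untwisted. [cite: BuchweitzFlenner2003, §5 Thm. 5.1 and Def. 4.1] [cite: Deligne1982HodgeCycles, proof of Thm. 4.8]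
[cite: Schoen1998HodgeWeilAddendum, 10 (Proposition), p. 332] -/
theorem weilTwelvefoldsSplit_and_below_of_BF_of_sheaf_six {C : ChernCharacterBetti}
    (hBF : BuchweitzFlenner2003_variationalHodge_ISemiregular) (hF : weilFamilyReach_hyperbolic) {d : ℕ} (hd : 0 < d)
    (P : AbelianVariety ℂ) (ψ₀ : P ⟶ P) (e : ProjectiveEmbedding P.X) (a : complexBetti (projectiveSpace e.n ℂ) 2)
    (hP : P.dim = 2 * 6) (hψ : ψ₀ ≫ ψ₀ = -(d • 𝟙 P)) (ha : IsRationalClass a) (ha0 : a ≠ 0)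
    (hhyp : IsHyperbolicWeilType P ψ₀ 6 (symmetrisedClass d P ψ₀ e a))
    (w : complexBetti P.X (2 * 6)) (hwW : w ∈ weilClassesOf P ψ₀ 6 d) (hwr : IsRationalClass w) (hw0 : w ≠ 0)
    (I : Finset ℕ) (h6 : 6 ∈ I) (E₀ : P.X.left.Modules) (hE₀ : IsFiniteLocallyFree E₀)
    (hsr : IsISemiregular hE₀ {q' | q' + 1 ∈ I}) (q : ℚ) (c : ℕ → ℚ)
    (hch6 : C.ch P.X E₀ 6 = ((q : ℚ) : ℂ) • cupPowTwo (symmetrisedClass d P ψ₀ e a) 6 + w)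
    (hchp : ∀ p ∈ I, p ≠ 6 → C.ch P.X E₀ p = ((c p : ℚ) : ℂ) • cupPowTwo (symmetrisedClass d P ψ₀ e a) p) :
    Stubs.WeilAlgebraicSplitHyperplane 6 d ∧
      (WeilAlgebraicAll 5 d ∧ WeilAlgebraicAll 4 d ∧ WeilAlgebraicAll 3 d ∧ WeilAlgebraicAll 2 d) :=
  weilTwelvefoldsSplit_and_below_of_BFmodel_of_sheaf_six (BuchweitzFlenner2003_variationalHodge_ISemiregular_model_of_fixed hBF)
    hF hd P ψ₀ e a hP hψ ha ha0 hhyp w hwW hwr hw0 I h6 E₀ hE₀ hsr q c hch6 hchp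

/-! ## An ARBITRARY discriminant component `(n, d, δ)`: the one-model sheaf doors of `ComponentCells.lean` with the fixed-fibre fact -/

/-- **The Weil-anchor local clause from ONE sheaf on ONE model, FIXED-FIBRE fact**:
`[Buchweitz–Flenner 5.1] ∧ HasBFSheafSeedOn C n I P h w ⟹ WeilAnchorLocalClause n d P h w`
(`weilAnchorLocalClause_of_BFmodel_of_sheafSeedOn` with the model rendering supplied by
`BuchweitzFlenner2003_variationalHodge_ISemiregular_model_of_fixed`). [cite: BuchweitzFlenner2003, §5 Thm. 5.1] -/
theorem weilAnchorLocalClause_of_BF_of_sheafSeedOn {n : ℕ} (d : ℕ) (C : ChernCharacterBetti) {I : Finset ℕ}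
    (hBF : BuchweitzFlenner2003_variationalHodge_ISemiregular) {P : AbelianVariety ℂ} {h : complexBetti P.X 2}
    {w : complexBetti P.X (2 * n)} (hS : HasBFSheafSeedOn C n I P h w) : WeilAnchorLocalClause n d P h w :=
  weilAnchorLocalClause_of_BFmodel_of_sheafSeedOn d C (BuchweitzFlenner2003_variationalHodge_ISemiregular_model_of_fixed hBF) hS

/-- **Door D2 in ONE-MODEL form on ANY cell `(n, d, δ)`, FIXED-FIBRE fact.** Granting BY NAME Deligne's reach-by-similitude
`weilFamilyReach_similar` and Buchweitz–Flenner Thm. 5.1 in its FIXED-FIBRE rendering `BuchweitzFlenner2003_variationalHodge_ISemiregular`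
(both REFEREED named facts): a polarized member `(P, ψ₀, h_K)` of Weil type `(n, d)` of the cell `δ`, a non-zero rational Weil class
`w` on it, and ONE `I`-semiregular finite locally free `ℰ₀` on `P.X` itself with `ch_n(ℰ₀) = q·h_Kⁿ + w`, `ch_p(ℰ₀) = c_p·h_Kᵖ`
(`p ∈ I ∖ {n}`, `n ∈ I`) — `HasBFSheafSeedOn C n I P h_K w` — ⟹ `WeilClassesComponent n d δ`
(`weilClassesComponent_of_sheafSeedOn_member` with the model rendering supplied by
`BuchweitzFlenner2003_variationalHodge_ISemiregular_model_of_fixed`). These are the cells — the NON-SPLIT ones — on which the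
existence clause of (S4) is open; nothing is asserted about any object. [cite: BuchweitzFlenner2003, §5 Thm. 5.1]
[cite: Deligne1982HodgeCycles, proof of Thm. 4.8] [cite: vanGeemen1994HodgeAV, Lemma 5.2 (3)–(4) and 5.3] -/
theorem weilClassesComponent_of_BF_of_sheafSeedOn_member {n d : ℕ} {δ : weilNormResidueGroup d}
    (hF : weilFamilyReach_similar) (C : ChernCharacterBetti) {I : Finset ℕ}
    (hBF : BuchweitzFlenner2003_variationalHodge_ISemiregular)
    {P : AbelianVariety ℂ} {ψ₀ : P ⟶ P} (hW : IsWeilType P ψ₀ n d) (e : ProjectiveEmbedding P.X)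
    {a : complexBetti (projectiveSpace e.n ℂ) 2} (haQ : IsRationalClass a) (ha0 : a ≠ 0)
    (hδ : HasWeilDiscriminantNondeg P ψ₀ n d (symmetrisedClass d P ψ₀ e a) δ)
    {w : complexBetti P.X (2 * n)} (hwW : w ∈ weilClassesOf P ψ₀ n d) (hwQ : IsRationalClass w) (hw0 : w ≠ 0)
    (hS : HasBFSheafSeedOn C n I P (symmetrisedClass d P ψ₀ e a) w) :
    WeilClassesComponent n d δ :=
  weilClassesComponent_of_sheafSeedOn_member hF C (BuchweitzFlenner2003_variationalHodge_ISemiregular_model_of_fixed hBF)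
    hW e haQ ha0 hδ hwW hwQ hw0 hS

/-- **`g = 6`, door D2 in ONE-MODEL form, cell `(3, d, δ)`, FIXED-FIBRE fact**: `weilFamilyReach_similar` ∧ [Buchweitz–Flenner 5.1]
(fixed-fibre rendering) ∧ ONE `I`-semiregular finite locally free `ℰ₀` on the sixfold `P.X` with `ch₃(ℰ₀) = q·h_K³ + w`,
`ch_p(ℰ₀) = c_p·h_Kᵖ` for `p ∈ I ∖ {3}` ⟹ `WeilClassesComponent 3 d δ`. [cite: BuchweitzFlenner2003, §5 Thm. 5.1]
[cite: Deligne1982HodgeCycles, proof of Thm. 4.8] [cite: vanGeemen1994HodgeAV, Lemma 5.2 (3)–(4) and 5.3] -/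
theorem weilSixfoldComponent_of_BF_of_sheafSeedOn_member {d : ℕ} {δ : weilNormResidueGroup d}
    (hF : weilFamilyReach_similar) (C : ChernCharacterBetti) {I : Finset ℕ}
    (hBF : BuchweitzFlenner2003_variationalHodge_ISemiregular)
    {P : AbelianVariety ℂ} {ψ₀ : P ⟶ P} (hW : IsWeilType P ψ₀ 3 d) (e : ProjectiveEmbedding P.X)
    {a : complexBetti (projectiveSpace e.n ℂ) 2} (haQ : IsRationalClass a) (ha0 : a ≠ 0)
    (hδ : HasWeilDiscriminantNondeg P ψ₀ 3 d (symmetrisedClass d P ψ₀ e a) δ)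
    {w : complexBetti P.X 6} (hwW : w ∈ weilClassesOf P ψ₀ 3 d) (hwQ : IsRationalClass w) (hw0 : w ≠ 0)
    (hS : HasBFSheafSeedOn C 3 I P (symmetrisedClass d P ψ₀ e a) w) :
    WeilClassesComponent 3 d δ :=
  weilClassesComponent_of_BF_of_sheafSeedOn_member hF C hBF hW e haQ ha0 hδ hwW hwQ hw0 hS

end Summit.Ventures.HSemireg

end
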